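import Mathlib
import Summits.Ventures.PercRepro2.CoinKSureAD

/-!
# Set-level Ahlswede–Daykin inequalities (blind cell PercRepro2, night-2 g27; §68.10)

The four functions theorem applied to laws restricted to SETS of clusters: if `s ∈ A`, `t ∈ B`
force `s ∩ t ∈ M`, `s ∪ t ∈ J` and the pointwise Holley inequality `L₁ s * L₂ t ≤ L₃ (s ∩ t) * L₄ (s ∪ t)`,
then `L₁(A) · L₂(B) ≤ L₃(M) · L₄(J)` (`ad_sets`).  This is the form in which the inequalities
between the cell masses of the chain laws (cells = unions of fibres over the entry states) enter
the certificates of (XA′): a set-level inequality for a UNION of cells is strictly stronger than the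
sum of its cell-pair parts whenever the meet / join sets overlap.
-/

namespace Summit.Ventures.PercRepro2.Coin

open Classical

section SetAD

variable {V : Type*} [DecidableEq V] {R : Type*} [Field R] [LinearOrder R] [IsStrictOrderedRing R]

/-- **Set-level four functions theorem.** Laws `L₁ … L₄ ≥ 0` on `U.powerset` and predicates
`PA PB PM PJ`; if for `s ∈ A := {PA}`, `t ∈ B := {PB}` (both `⊆ U`) the meet lies in `M`, the join in `J`
and `L₁ s * L₂ t ≤ L₃ (s ∩ t) * L₄ (s ∪ t)`, then `L₁(A) * L₂(B) ≤ L₃(M) * L₄(J)`. -/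
theorem ad_sets (U : Finset V) (L₁ L₂ L₃ L₄ : Finset V → R)
    (h₁ : ∀ W, 0 ≤ L₁ W) (h₂ : ∀ W, 0 ≤ L₂ W) (h₃ : ∀ W, 0 ≤ L₃ W) (h₄ : ∀ W, 0 ≤ L₄ W)
    (PA PB PM PJ : Finset V → Prop)
    (h : ∀ s ⊆ U, ∀ t ⊆ U, PA s → PB t →
      PM (s ∩ t) ∧ PJ (s ∪ t) ∧ L₁ s * L₂ t ≤ L₃ (s ∩ t) * L₄ (s ∪ t)) :
    (∑ W ∈ U.powerset.filter PA, L₁ W) * (∑ W ∈ U.powerset.filter PB, L₂ W) ≤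
      (∑ W ∈ U.powerset.filter PM, L₃ W) * (∑ W ∈ U.powerset.filter PJ, L₄ W) := by
  simp only [Finset.sum_filter]
  have n₁ : ∀ W, (0 : R) ≤ (if PA W then L₁ W else 0) := fun W => by
    split_ifs <;> first | exact le_rfl | exact h₁ W
  have n₂ : ∀ W, (0 : R) ≤ (if PB W then L₂ W else 0) := fun W => by
    split_ifs <;> first | exact le_rfl | exact h₂ W
  have n₃ : ∀ W, (0 : R) ≤ (if PM W then L₃ W else 0) := fun W => by
    split_ifs <;> first | exact le_rfl | exact h₃ W
  have n₄ : ∀ W, (0 : R) ≤ (if PJ W then L₄ W else 0) := fun W => by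
    split_ifs <;> first | exact le_rfl | exact h₄ W
  refine ad_pointwise U _ _ _ _ n₁ n₂ n₃ n₄ ?_
  intro s hs t ht
  by_cases hA : PA s
  · by_cases hB : PB t
    · obtain ⟨hM, hJ, hle⟩ := h s hs t ht hA hB
      rw [if_pos hA, if_pos hB, if_pos hM, if_pos hJ]
      exact hle
    · rw [if_neg hB, mul_zero]
      exact mul_nonneg (n₃ _) (n₄ _)
  · rw [if_neg hA, zero_mul]
    exact mul_nonneg (n₃ _) (n₄ _)

end SetAD

end Summit.Ventures.PercRepro2.Coin
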